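import Summits.BirchSwinnertonDyer.BirchSwinnertonDyer.Theorems.EisensteinPrimesSurLambdaSurOfTower
import Literature.NumberTheory.GaloisRepresentations.TateDualLimitUnramifiedLevels
import Literature.NumberTheory.IwasawaTheory.Greenberg2016.CompactDualSelmer
import HarnessLib

/-!
# Road «SUR-Λ» (crux 2 `GoodLatticeBDPValue`, by-name input #9 `Greenberg2016.prop263_sur_of_crk`),
# brick C6 (final part): «`S_{𝓛*}(K, T*) = 0` ⟹ every thread of the dual Selmer tower is zero ⟹ SUR»

Cell `bsd-eis`, width seat `bsd-line-x1-p1-w2` (gen 10); helper for stmt-BirchSwinnertonDyer-19032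
(`--supports`), road memo `SUR-LAMBDA-ROAD-w5g9.md` §2 ★(ε), §7.4 C6.  THEOREMS ONLY (no definition, no
named fact, no `sorry`).

MATHEMATICS (R. Greenberg, Kyoto J. Math. 50 (2010), proof of Prop. 3.2.1, p. 15): "Now assume that
`S_{𝓛*}(K, T*) = 0`. … it follows that `φ_𝓛` is surjective."  Here `S_{𝓛*}(K, T*) ⊆ H¹(K_Σ/K, T*)`
is cut out by `loc_v y ∈ L(K_v, T*) = L(K_v, D)^⊥` (`v ∈ Σ`) for the `Λ`-adic local pairings (5);
membership in `H¹(K_Σ/K, T*)` means unramified outside `Σ`.  In the tree: `T* = lim_k Hom(D_k, μ_{p^k})`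
(`TorsionLayers.dualSystem`), `H¹_cont(Γ_K, T*)`, `locDual`, `dualLocalCondition` for THE canonical
local invariant maps (`LocalInvariants.canonical`, level-change law `canonical_map_muIncl`); the
hypothesis **`hS0`** below says: every `Y ∈ H¹_cont(Γ_K, T*)` whose components `Y_k` are unramified at
the finite places outside `T = Σ` and whose localisations `loc_v Y`, `v ∈ T`, lie in `L_v^⊥` is `0`.

* `invLevelLaw_canonical` — the canonical invariant maps satisfy the level-change law
  (`PoitouTateReduction.canonical_map_muIncl`, Serre XIII §3 Cor. 3).
* **`threads_eq_zero_of_limitSelmer_eq_zero`** (tower-generic) — `hS0` ⟹ for every `m₀`, every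
  one-step-compatible thread `(y_j ∈ H¹_{𝓕_{m₀+j}^*})_j` of canonical dual Selmer classes of the level
  conditions `𝓕_k = E.levelSelmerStructure 𝓛 T k` is zero: the thread is the family of components of a
  limit class `Y` (`exists_limitClass_of_thread`), ALL of whose components lie in the dual Selmer groups
  (the dual Selmer tower, `cohomologyMap_dualRes_mem_dualSelmer`); those are unramified off `T` (Milne
  I 2.6 for the canonical family, `unramifiedOrthogonal_of_isPerfect_allLevels`) and their local
  conditions on `T` are the levelwise reading of `L_v^⊥` (`locDual_mem_dualLocalCondition_iff`); so
  `hS0` kills `Y`, hence every `y_j = Y_{m₀+j}`.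
* **`sur_of_limitSelmer_eq_zero`** — Greenberg's (ε) in the `T*`-currency: for `𝐃`, `ρ`, `𝓛`, the
  `Λ`-levels `N k` and `T = Σ` as in `sur_of_forall_threads_eq_zero` (C6c), `hS0` for
  `E = lambdaTorsionLayers S ρ p N …` and `𝓛 := specSelmerStructure S ρ L` ⟹ `L.SUR`.
* **`sur_of_dualSelmer_eq_zero`** — the same for Greenberg's layers `𝐃[𝔪ᵏ]` (`torsionLayers ρ e hD`,
  `Λ ≅ ℤ_p⟦T₁,…,T_m⟧`, `𝐃` cofinitely generated) in the currency of the dictionary's `S_{𝓛*}(K, T*)`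
  (`CompactDualSelmer.dualSelmer`, canonical invariants): **`(∀ y ∈ dualSelmer ρ e hD (canonical) L,
  y = 0) → L.SUR`** — verbatim the hypothesis `hC6` of `Specification.sur_of_dualSelmer_inputs`
  (`GlobalToLocalSurjectivityCaseCInputs.lean`) at `inv := LocalInvariants.canonical`.  The off-`Σ`
  clause of `dualSelmer` (`loc_w y ⊥ H¹_ur(K_w, 𝐃)`) is read levelwise by
  `locDual_mem_dualLocalCondition_unramified_iff` (`𝐃` is unramified off `S`, Milne I 2.6).

What is NOT here: Greenberg's deduction of `S_{𝓛*}(K, T*) = 0` from CRK, `𝓛` almost divisible,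
LOC₁/LOC₂ and `Ш`-duality (Prop. 3.2.1 (α)–(δ); other seats of the road), and the instantiation
`N k := 𝐃[𝔪ᵏ]` (C7).

HONEST FRAMING: a helper; closes no stub; no case of Greenberg's Prop. 2.6.3 / 3.2.1 beyond the
displayed implications, of Poitou–Tate duality beyond the tree theorems invoked, or of BSD is proved
here; no summit statement is proved.
References: [Greenberg2010] §2 p. 6, §3.1 p. 14, Prop. 3.2.1 (p. 15); [MilneADT2006] I Thm. 2.6,
Thm. 4.10 (b); [SerreLocalFields1979] XIII §3 Cor. 3; [NeukirchSchmidtWingberg2008] (2.7.5).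
-/

set_option autoImplicit false
set_option linter.dupNamespace false

noncomputable section

open CategoryTheory Function NumberField IsDedekindDomain Field
open scoped NumberField ContRepresentation

namespace Summit.BirchSwinnertonDyer.BirchSwinnertonDyer.Theorems.SurLambda

open Literature.NumberTheory.GaloisRepresentations Literature.NumberTheory.GaloisCohomology
open Literature.NumberTheory.GaloisRepresentations.DiscreteGaloisModule (tateDual localTatePairingZMod
  unramifiedSubgroup SelmerStructure)
open Literature.NumberTheory.GaloisRepresentations.DiscreteGaloisModule.TorsionLayers
open Literature.NumberTheory.IwasawaTheory.Greenberg2016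
open Literature.NumberTheory.IwasawaTheory.Greenberg2006 (IsCofinitelyGenerated)
open Summit.BirchSwinnertonDyer.BirchSwinnertonDyer.Theorems.SchneiderFreeAdditiveX3.PoitouTateReduction
  (canonical_map_muIncl unramifiedOrthogonal_of_isPerfect_allLevels)
open _root_.ContinuousCohomology

section Tower

variable {K : Type} [Field K] [NumberField K] {D : Type} [AddCommGroup D] [TopologicalSpace D]
  [DiscreteTopology D] {τ : DiscreteGaloisModule K D} {p : ℕ} [Fact p.Prime]
  (E : τ.TorsionLayers p) [∀ k, Finite (E.N k)]

omit [∀ k, Finite (E.N k)] in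
/-- **The canonical local invariant maps satisfy the level-change law** at every place (Serre XIII §3
Cor. 3; the tree's `canonical_map_muIncl`). [cite: SerreLocalFields1979, XIII §3 Cor. 3] -/
theorem invLevelLaw_canonical (v : Place K) :
    InvLevelLaw (K := K) (fun k => LocalInvariants.canonical K (p ^ k)) v :=
  fun _ _ h j hj z => canonical_map_muIncl (pow_dvd_pow p h) j hj v z

/-- **«`S_{𝓛*}(K, T*) = 0` ⟹ every thread of the canonical dual Selmer tower is zero»** (tower-generic;
see the module docstring for `hS0`).  For `T ⊇ Ω_∞ ∪ {v ∣ p}` finite with the layers unramified off `T`,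
a Selmer structure `𝓛` on `D` and the level conditions `𝓕_k = E.levelSelmerStructure 𝓛 T k`: every
one-step-compatible thread `(y_j ∈ H¹_{𝓕_{m₀+j}^*}(K, Hom(D_{m₀+j}, μ_{p^{m₀+j}})))_j` vanishes.
[cite: Greenberg2010, Prop. 3.2.1 (p. 15)] [cite: MilneADT2006, Ch. I, Thm. 2.6]
[cite: NeukirchSchmidtWingberg2008, II §7 Thm 2.7.5] -/
theorem threads_eq_zero_of_limitSelmer_eq_zero [CompactSpace (absoluteGaloisGroup K)]
    (T : Finset (Place K)) (hTinl : ∀ w : InfinitePlace K, (Sum.inl w : Place K) ∈ T)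
    (hTp : ∀ v : HeightOneSpectrum (𝓞 K), ((p : ℕ) : 𝓞 K) ∈ v.asIdeal → (Sum.inr v : Place K) ∈ T)
    (hur : ∀ (k : ℕ) (v : HeightOneSpectrum (𝓞 K)), (Sum.inr v : Place K) ∉ T →
      GaloisRep.IsUnramifiedAt v (E.layerRep k))
    (𝓛 : SelmerStructure τ)
    (hS0 : ∀ Y : continuousCohomology 1 E.dualSystem.limitRep.toTopRep,
      (∀ (k : ℕ) (w : HeightOneSpectrum (𝓞 K)), (Sum.inr w : Place K) ∉ T →
        galoisCohomology.localization ((E.layerRep k).tateDual (p ^ k)) (Sum.inr w) 1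
            (cohomologyMap (E.dualSystem.projHom k) 1 Y) ∈
          unramifiedSubgroup (GaloisRep.toLocal w ((E.layerRep k).tateDual (p ^ k))) 1) →
      (∀ v ∈ T, E.locDual (absGaloisRestrict K (Place.Completion v)) Y ∈
        E.dualLocalCondition (fun k => LocalInvariants.canonical K (p ^ k)) v (𝓛 v)) →
      Y = 0)
    (m₀ : ℕ) (y : ∀ j : ℕ, galoisCohomology ((E.layerRep (m₀ + j)).tateDual (p ^ (m₀ + j))) 1)
    (hy : ∀ j, y j ∈ ((LocalInvariants.canonical K (p ^ (m₀ + j))).dualSelmerStructure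
      (E.layerRep (m₀ + j)) (E.levelSelmerStructure 𝓛 T (m₀ + j))).selmerGroup)
    (hcompat : ∀ j, cohomologyMap (E.dualSystem.redHom (Nat.le_succ (m₀ + j))) 1 (y (j + 1)) = y j) :
    ∀ j, y j = 0 := by
  -- the thread is the family of components of a limit class `Y`
  obtain ⟨Y, hY⟩ := E.exists_limitClass_of_thread m₀ y hcompat
  -- all components of `Y` lie in the dual Selmer groups (the dual Selmer tower)
  have hSel : ∀ k, cohomologyMap (E.dualSystem.projHom k) 1 Y ∈
      ((LocalInvariants.canonical K (p ^ k)).dualSelmerStructure (E.layerRep k)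
        (E.levelSelmerStructure 𝓛 T k)).selmerGroup := by
    intro k
    have h : k ≤ m₀ + k := Nat.le_add_left k m₀
    have hk : cohomologyMap (E.dualSystem.redHom h) 1 (y k) = cohomologyMap (E.dualSystem.projHom k) 1 Y := by
      rw [← hY k]
      exact E.cohomologyMap_redHom_projHom h Y
    rw [← hk]
    exact cohomologyMap_dualRes_mem_dualSelmer E h _ _
      (E.map_layerInclHom_mem_levelSelmerStructure 𝓛 hTinl h) (hy k)
  -- Howard's hypothesis on `T` at every level, and `𝓕_k^*` unramified off `T` (Milne I 2.6)
  have hT : ∀ (k : ℕ) (v : HeightOneSpectrum (𝓞 K)), (Sum.inr v : Place K) ∉ T →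
      ((p ^ k : ℕ) : 𝓞 K) ∉ v.asIdeal ∧ GaloisRep.IsUnramifiedAt v (E.layerRep k) := by
    intro k v hv
    refine ⟨fun h => hv (hTp v (v.isPrime.mem_of_pow_mem k ?_)), hur k v hv⟩
    rwa [← Nat.cast_pow]
  have hdual : ∀ k, ((LocalInvariants.canonical K (p ^ k)).dualSelmerStructure (E.layerRep k)
      (E.levelSelmerStructure 𝓛 T k)).IsUnramifiedOutside T := fun k =>
    (unramifiedOrthogonal_of_isPerfect_allLevels _ LocalInvariants.canonical_isPerfect)
      |>.isUnramifiedOutside_dualSelmerStructure (E.layerRep k) (fun x => E.pow_smul_eq_zero x) (hT k)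
        (E.isUnramifiedOutside_levelSelmerStructure 𝓛 hTinl k)
  -- `hS0` kills `Y`
  have hY0 : Y = 0 := by
    refine hS0 Y (fun k w hw => ?_) (fun v hv => ?_)
    · have h := (SelmerStructure.mem_selmerGroup_iff _ _).1 (hSel k) (Sum.inr w)
      rw [(hdual k).2 w hw] at h
      exact h
    · refine (locDual_mem_dualLocalCondition_iff (invLevelLaw_canonical v) (𝓛 v) Y).2 fun k => ?_
      have h := (SelmerStructure.mem_selmerGroup_iff _ _).1 (hSel k) v
      rw [LocalInvariants.dualSelmerStructure_apply, E.levelSelmerStructure_of_mem 𝓛 k hv] at h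
      exact h
  intro j
  have hj := hY j
  rw [hY0, map_zero] at hj
  exact hj.symm

end Tower

section Greenberg

variable {K : Type} [Field K] [NumberField K] {S : Set (HeightOneSpectrum (𝓞 K))} [Finite (SigmaPlace S)]
  {Λ : Type} [CommRing Λ] [TopologicalSpace Λ]
  {D : Type} [AddCommGroup D] [Module Λ D] [TopologicalSpace D] [DiscreteTopology D]
  [ContinuousSMul Λ D]
  (ρ : ContinuousRep (GaloisGroupUnramifiedOutside K S) Λ D) (L : Specification S ρ)
  {p : ℕ} [Fact p.Prime]

/-- **Greenberg 2010, Prop. 3.2.1, step (ε) in the `T*`-currency: «`S_{𝓛*}(K, T*) = 0` ⟹ SUR(𝐃, 𝓛)».**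
For `𝐃`, `ρ`, `𝓛`, finite stable `Λ`-levels `N k` (`p^k · N k = 0`, increasing, exhaustive) and
`T = Σ ⊇ Ω_∞` with `T ∩ {finite} = S ∋ {v ∣ p}`: if every `Y ∈ H¹_cont(Γ_K, T*)`
(`T* = lim_k Hom(N k, μ_{p^k})`) whose components are unramified at the finite places outside `T` and
whose localisations on `T` lie in `L(K_v, 𝐃)^⊥` (canonical `Λ`-adic local pairings) vanishes, then
`φ_𝓛` is surjective.  (`threads_eq_zero_of_limitSelmer_eq_zero` + `sur_of_forall_threads_eq_zero`.)
[cite: Greenberg2010, Prop. 3.2.1 (p. 15) and Prop. 3.1.1 (p. 14)] [cite: MilneADT2006, Ch. I, Thm. 4.10 (b)] -/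
theorem sur_of_limitSelmer_eq_zero [CompactSpace (absoluteGaloisGroup K)]
    (hSp : ∀ v : HeightOneSpectrum (𝓞 K), ((p : ℕ) : 𝓞 K) ∈ v.asIdeal → v ∈ S)
    -- the finite `Λ`-levels
    (N : ℕ → Submodule Λ D) (hmono : Monotone N)
    (hN : ∀ (k : ℕ) (g : GaloisGroupUnramifiedOutside K S), N k ≤ (N k).comap (ρ g))
    (htors : ∀ (k : ℕ), ∀ d ∈ N k, (p ^ k) • d = 0) (hfin : ∀ k, Finite (N k))
    (hex : ∀ d : D, ∃ k, d ∈ N k)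
    -- `Σ` as a Finset of places
    (T : Finset (Place K)) (hTinl : ∀ w : InfinitePlace K, (Sum.inl w : Place K) ∈ T)
    (hTinr : ∀ v : HeightOneSpectrum (𝓞 K), (Sum.inr v : Place K) ∈ T ↔ v ∈ S)
    -- «S_{𝓛*}(K, T*) = 0»
    (hS0 : haveI := (lambdaTorsionLayers S ρ p N hmono hN htors hfin hex).finite
      ∀ Y : continuousCohomology 1
        (lambdaTorsionLayers S ρ p N hmono hN htors hfin hex).dualSystem.limitRep.toTopRep,
      (∀ (k : ℕ) (w : HeightOneSpectrum (𝓞 K)), (Sum.inr w : Place K) ∉ T →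
        galoisCohomology.localization
            (((lambdaTorsionLayers S ρ p N hmono hN htors hfin hex).layerRep k).tateDual (p ^ k))
            (Sum.inr w) 1
            (cohomologyMap ((lambdaTorsionLayers S ρ p N hmono hN htors hfin hex).dualSystem.projHom k)
              1 Y) ∈
          unramifiedSubgroup (GaloisRep.toLocal w
            (((lambdaTorsionLayers S ρ p N hmono hN htors hfin hex).layerRep k).tateDual (p ^ k))) 1) →
      (∀ v ∈ T, (lambdaTorsionLayers S ρ p N hmono hN htors hfin hex).locDual
          (absGaloisRestrict K (Place.Completion v)) Y ∈
        (lambdaTorsionLayers S ρ p N hmono hN htors hfin hex).dualLocalCondition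
          (fun k => LocalInvariants.canonical K (p ^ k)) v (specSelmerStructure S ρ L v)) →
      Y = 0) :
    L.SUR := by
  haveI hfinE : ∀ k, Finite ((lambdaTorsionLayers S ρ p N hmono hN htors hfin hex).N k) :=
    fun k => hfin k
  have hTp : ∀ v : HeightOneSpectrum (𝓞 K), ((p : ℕ) : 𝓞 K) ∈ v.asIdeal → (Sum.inr v : Place K) ∈ T :=
    fun v h => (hTinr v).2 (hSp v h)
  have hur : ∀ (k : ℕ) (v : HeightOneSpectrum (𝓞 K)), (Sum.inr v : Place K) ∉ T →
      GaloisRep.IsUnramifiedAt v ((lambdaTorsionLayers S ρ p N hmono hN htors hfin hex).layerRep k) :=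
    fun k v hv => isUnramifiedAt_layerRep_lambdaTorsionLayers S ρ p N hmono hN htors hfin hex k
      fun h => hv ((hTinr v).2 h)
  exact sur_of_forall_threads_eq_zero ρ L hSp N hmono hN htors hfin hex T hTinl hTinr
    fun m₀ y hy hc => threads_eq_zero_of_limitSelmer_eq_zero
      (lambdaTorsionLayers S ρ p N hmono hN htors hfin hex) T hTinl hTp hur
      (specSelmerStructure S ρ L) hS0 m₀ y hy hc

/-- **Greenberg 2010, Prop. 3.2.1, step (ε) for `T* = lim_k Hom(𝐃[𝔪ᵏ], μ_{p^k})`: «`S_{𝓛*}(K, T*) = 0` ⟹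
SUR(𝐃, 𝓛)»**, in the currency of the dictionary's `dualSelmer` (canonical local invariant maps) —
the hypothesis `hC6` of `Specification.sur_of_dualSelmer_inputs`.  Here `Λ ≅ ℤ_p⟦T₁,…,T_m⟧`, `𝐃` is a
cofinitely generated discrete `Λ`-module with its continuous `Λ`-linear `Gal(K_Σ/K)`-action `ρ`, `Σ`
(= the archimedean places and `S ∋ {v ∣ p}`) is finite, and `𝓛` is any specification.
[cite: Greenberg2010, Prop. 3.2.1 (p. 15) and Prop. 3.1.1 (p. 14)] [cite: MilneADT2006, Ch. I, Thm. 2.6, Thm. 4.10 (b)] -/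
theorem sur_of_dualSelmer_eq_zero [IsTopologicalRing Λ] [IsLocalRing Λ] {m : ℕ}
    (e : Λ ≃+* MvPowerSeries (Fin m) ℤ_[p]) (hD : IsCofinitelyGenerated Λ D)
    [CompactSpace (absoluteGaloisGroup K)]
    (hSp : ∀ v : HeightOneSpectrum (𝓞 K), ((p : ℕ) : 𝓞 K) ∈ v.asIdeal → v ∈ S)
    (h0 : ∀ y ∈ dualSelmer ρ e hD (fun k => LocalInvariants.canonical K (p ^ k)) L, y = 0) :
    L.SUR := by
  classical
  -- `Σ` as a Finset of places
  obtain ⟨T, hT⟩ : ∃ T : Finset (Place K), ∀ v : Place K, v ∈ T ↔ InSigma S v := by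
    haveI : Fintype (SigmaPlace S) := Fintype.ofFinite _
    refine ⟨Finset.univ.image fun v : SigmaPlace S => (v.1 : Place K), fun v => ?_⟩
    simp only [Finset.mem_image, Finset.mem_univ, true_and]
    exact ⟨fun ⟨u, hu⟩ => hu ▸ u.2, fun h => ⟨⟨v, h⟩, rfl⟩⟩
  have hTinl : ∀ w : InfinitePlace K, (Sum.inl w : Place K) ∈ T := fun w => (hT _).2 (inSigma_inl S w)
  have hTinr : ∀ v : HeightOneSpectrum (𝓞 K), (Sum.inr v : Place K) ∈ T ↔ v ∈ S :=
    fun v => (hT _).trans (inSigma_inr_iff S v)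
  -- the `Λ`-tower `𝐃[𝔪ᵏ]` and its axioms (as in `torsionLayers`)
  obtain ⟨N, hNdef⟩ : ∃ N : ℕ → Submodule Λ D,
      N = fun k => Submodule.torsionBySet Λ D ((IsLocalRing.maximalIdeal Λ ^ k : Ideal Λ) : Set Λ) :=
    ⟨_, rfl⟩
  have hmono : Monotone N := by
    subst hNdef
    intro k l hkl d hd
    rw [Submodule.mem_torsionBySet_iff] at hd ⊢
    rintro ⟨r, hr⟩
    exact hd ⟨r, Ideal.pow_le_pow_right hkl hr⟩
  have hN : ∀ (k : ℕ) (g : GaloisGroupUnramifiedOutside K S), N k ≤ (N k).comap (ρ g) := by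
    subst hNdef
    intro k g d hd
    rw [Submodule.mem_comap, Submodule.mem_torsionBySet_iff]
    rw [Submodule.mem_torsionBySet_iff] at hd
    intro r
    rw [← map_smul, hd r, map_zero]
  have htors : ∀ (k : ℕ), ∀ d ∈ N k, (p ^ k) • d = 0 := by
    subst hNdef
    exact fun k d hd => (torsionLayers ρ e hD).torsion k d hd
  have hfin : ∀ k, Finite (N k) := by
    subst hNdef
    exact fun k => (torsionLayers ρ e hD).finite k
  have hex : ∀ d : D, ∃ k, d ∈ N k := by
    subst hNdef
    exact fun d => (torsionLayers ρ e hD).exhaustive d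
  subst hNdef
  haveI hfinE : ∀ k, Finite ((lambdaTorsionLayers S ρ p _ hmono hN htors hfin hex).N k) := fun k => hfin k
  refine sur_of_limitSelmer_eq_zero ρ L hSp _ hmono hN htors hfin hex T hTinl hTinr ?_
  intro Y hA hB
  refine h0 Y ((mem_dualSelmer_iff ρ e hD _ L Y).2 ⟨fun v hv => hB v ((hT v).2 hv), fun w hw => ?_⟩)
  have hwT : (Sum.inr w : Place K) ∉ T := fun h => hw ((hTinr w).1 h)
  have hp : ∀ k : ℕ, ((p ^ k : ℕ) : 𝓞 K) ∉ w.asIdeal := fun k h =>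
    hw (hSp w (w.isPrime.mem_of_pow_mem k (by rwa [← Nat.cast_pow])))
  exact ((lambdaTorsionLayers S ρ p _ hmono hN htors hfin hex).locDual_mem_dualLocalCondition_unramified_iff
    (invLevelLaw_canonical (Sum.inr w : Place K))
    (fun k => unramifiedOrthogonal_of_isPerfect_allLevels _ LocalInvariants.canonical_isPerfect) hp
    (isUnramifiedOutside_toGaloisModule S ρ w hw) Y).2 fun k => hA k w hwT

end Greenberg

end Summit.BirchSwinnertonDyer.BirchSwinnertonDyer.Theorems.SurLambda
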